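import Literature.Analysis.FluidPDE.TaoLocalisation
import Literature.Analysis.FunctionSpaces.SobolevImbeddingSup
import HarnessLib

/-!
# Discharge of `NS.linfty_bound_of_hasBoundedSobolevNormsOn` (Sobolev imbedding `H² ⊂ L^∞`)

`Literature.Analysis.FluidPDE.TaoLocalisation` records, as the named fact
`Literature.Analysis.FluidPDE.linfty_bound_of_hasBoundedSobolevNormsOn`, the form of the Sobolev imbedding
`W^{2,2}(ℝ³) → C_B(ℝ³)` (R. A. Adams, *Sobolev Spaces* (1975), Thm. 5.4 Part I Case C, `mp > n`
with `m = p = 2`, `n = 3`; = Adams–Fournier (2003), Thm. 4.12 Part I Case A) consumed by the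
Navier–Stokes files: a velocity field `u : ℝ → ℝ³ → ℝ³` with `C²` slices `u t`, `t ∈ S`, all of
whose spatial derivatives have `L²(ℝ³)` norms bounded uniformly in `t ∈ S`
(`NS.HasBoundedSobolevNormsOn S u`), is bounded on `S × ℝ³`.

This file proves it (`NS.linfty_bound_of_hasBoundedSobolevNormsOn_holds`) from the proved
imbedding with explicit finite constant
`Literature.Analysis.FunctionSpaces.exists_enorm_le_sobolev_two_two_dim_three`
(`Literature.Analysis.FunctionSpaces.SobolevImbeddingSup`, following Adams' printed proof,
Lemma 5.15: Morrey's inequality for `p = 6 > 3` and the Gagliardo–Nirenberg–Sobolev inequality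
`W^{2,2} → W^{1,6}`): `‖g(x)‖ ≤ K (‖g‖_{L²} + ‖Dg‖_{L²} + ‖D²g‖_{L²})` for every `C²` map `g` on
a `3`-dimensional space, applied to `g = u t` with the uniform bounds `C₀, C₁, C₂` of the
hypothesis (only the orders `n ≤ 2` of `HasBoundedSobolevNormsOn` are used, as the docstring of
the fact says).

## References

* R. A. Adams, *Sobolev Spaces*, Academic Press (1975), Thm. 5.4 Part I Case C, Lemma 5.15.
* R. A. Adams, J. J. F. Fournier, *Sobolev Spaces*, 2nd ed. (2003), Thm. 4.12 Part I Case A.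
-/

noncomputable section

open MeasureTheory Set Module
open scoped ENNReal NNReal ContDiff

namespace Literature.Analysis.FluidPDE

/-- For `f` with `∫⁻ ‖f‖ₑ² ≤ C` one has `‖f‖_{L²} ≤ C^{1/2}`. [folklore] -/
theorem eLpNorm_two_le_rpow_of_lintegral_sq_le {α F : Type*} [MeasurableSpace α]
    {μ : Measure α} [NormedAddCommGroup F] {f : α → F} {C : ℝ≥0∞}
    (h : ∫⁻ x, ‖f x‖ₑ ^ 2 ∂μ ≤ C) : eLpNorm f 2 μ ≤ C ^ (1 / 2 : ℝ) := by
  rw [eLpNorm_eq_lintegral_rpow_enorm_toReal two_ne_zero ENNReal.ofNat_ne_top,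
    ENNReal.toReal_ofNat]
  gcongr
  refine le_of_eq_of_le (lintegral_congr fun x => ?_) h
  exact ENNReal.rpow_two _

/-- **Discharge of `linfty_bound_of_hasBoundedSobolevNormsOn`** (Adams, *Sobolev Spaces*
(1975), Thm. 5.4 Part I Case C with `m = p = 2`, `n = 3`, `j = 0`, `Ω = ℝ³`; Adams–Fournier
(2003) Thm. 4.12 Part I Case A): if every slice `u t`, `t ∈ S`, is `C²` and the `L²(ℝ³)` norms
of `Dⁿ(u t)` are bounded uniformly in `t ∈ S` for every `n`, then `u` is bounded on `S × ℝ³`,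
namely by `K (C₀^{1/2} + C₁^{1/2} + C₂^{1/2})` with `K` the imbedding constant of
`exists_enorm_le_sobolev_two_two_dim_three` and `Cₙ` the bounds of the hypothesis. [cite: Adams1975, Thm. 5.4 Part I Case C (mp > n) and Lemma 5.15]
[cite: AdamsFournier2003, Thm. 4.12 (p. 85) Part I Case A (mp > n)] -/
theorem linfty_bound_of_hasBoundedSobolevNormsOn_holds :
    linfty_bound_of_hasBoundedSobolevNormsOn := by
  intro S u hu hH
  obtain ⟨K, hK, hbound⟩ := FunctionSpaces.exists_enorm_le_sobolev_two_two_dim_three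
    (E := EuclideanSpace ℝ (Fin 3)) (F := EuclideanSpace ℝ (Fin 3))
    (volume : Measure (EuclideanSpace ℝ (Fin 3))) finrank_euclideanSpace_fin
  choose C hC using hH
  set R : ℝ≥0∞ := K * ∑ j ∈ Finset.range 3, ((C j : ℝ≥0∞) ^ (1 / 2 : ℝ)) with hR
  have hRtop : R < ⊤ := by
    refine ENNReal.mul_lt_top hK (ENNReal.sum_lt_top.2 fun j _ => ?_)
    exact ENNReal.rpow_lt_top_of_nonneg (by norm_num) ENNReal.coe_ne_top
  refine ⟨R.toReal, fun t ht x => ?_⟩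
  have h1 : ‖u t x‖ₑ ≤ R := by
    refine (hbound (u t) (hu t ht) x).trans ?_
    rw [hR]
    gcongr with j hj
    exact eLpNorm_two_le_rpow_of_lintegral_sq_le (hC j t ht)
  calc ‖u t x‖ = (‖u t x‖ₑ).toReal := (toReal_enorm (u t x)).symm
    _ ≤ R.toReal := ENNReal.toReal_mono hRtop.ne h1

end Literature.Analysis.FluidPDE

end
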